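import Summits.ValiantsHypothesis.ValiantsHypothesis.Theses.BinomialElusive

/-!
# `BinomialCandidate` (crux stmt-ValiantsHypothesis-7392): small levels and load-bearing hypotheses

Negative-lane certificate for the crux `X = BinomialCandidate` of route `BinomialElusive`
(`∃ m₀, ∀ m ≥ m₀`, no quadratic `Γ : ℂ^{m-1} → ℂ^m` has image containing the binomial curve
`x ↦ (x^{E(2i+1)} + x^{E(2i+2)})_{i<m}`, `E(j) = Σ_{k≤h} (j M)^k`, `h = ⌊log₂ m⌋²`, `M = (2m+2)^{h+1}`).
Refuter crux-attack, one cycle (2026-08-17); no kill. Write `Level m` for the body of `X` at level `m`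
(spelled out verbatim below; `X ↔ ∃ m₀, ∀ m ≥ m₀, Level m` by `Iff.rfl`). Certified here:

* `level_zero_false` — `Level 0` fails (everything is the point `ℂ^0`).
* `level_three_false` — **`Level 3` fails**: `⌊log₂ 3⌋² = 1`, `M = 64`, `E(j) = 1 + 64 j`, all gaps equal
  `64`, the curve is `x^65 (1 + x^64) · (1, x^128, x^256)`, inside the cone `w₀ w₂ = w₁²`, which is the
  image of the quadratic map `(t, u) ↦ (t², t u, u²)`.  So the guard `∃ m₀` is load-bearing exactly
  through the equal-gap levels `h = 1` (`m ≤ 3`), and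
* `four_le_of_binomialCandidate_witness` — every witness `m₀` of `X` has `4 ≤ m₀`: a proof of `X`
  cannot be uniform in `m ≥ 1` and must use `h ≥ 2` (pairwise distinct gaps — the injectivity
  hypothesis of the proved support `ToricBinomialElusive` fails precisely at these levels, and the
  swallower above is a monomial map).
* `false_withoutDegree` — dropping `totalDegree ≤ 2` makes the eventual statement false (the curve
  itself, read in the first of the `m - 1 ≥ 1` variables, swallows it).
* `false_withoutDeficit` — with `m` instead of `m - 1` variables the eventual statement is false
  (coordinate functions, degree `1`).
* `level_const` — constant maps never swallow (`f(0) = 0 ≠ f(1) = (2, …, 2)`), every `m ≥ 1`.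

No declaration here is a definition and no conclusion asserts a Theses declaration positively.
-/

namespace Summit.ValiantsHypothesis.ValiantsHypothesis.Theorems.BinomialCandidate.Negative

-- summit = sub-problem name (single-conjunct summit, D-0017 layout), so the namespace repeats it
set_option linter.dupNamespace false

open Summit.ValiantsHypothesis.ValiantsHypothesis.Theses.BinomialElusive (BinomialCandidate)

/-- `Level 0` fails: source and target are the one-point space `ℂ^0`. -/
theorem level_zero_false : ¬ (∀ Γ : Fin 0 → MvPolynomial (Fin (0 - 1)) ℂ, (∀ i, (Γ i).totalDegree ≤ 2) →
      ¬ (Set.range (fun x : ℂ => fun i : Fin 0 => x ^ (∑ k ∈ Finset.range (Nat.log 2 0 ^ 2 + 1), ((2 * (i : ℕ) + 1) * (2 * 0 + 2) ^ (Nat.log 2 0 ^ 2 + 1)) ^ k) + x ^ (∑ k ∈ Finset.range (Nat.log 2 0 ^ 2 + 1), ((2 * (i : ℕ) + 2) * (2 * 0 + 2) ^ (Nat.log 2 0 ^ 2 + 1)) ^ k))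
        ⊆ Set.range (fun y : Fin (0 - 1) → ℂ => fun i : Fin 0 => MvPolynomial.eval y (Γ i)))) := by
  intro h
  refine h (fun _ => 0) (fun _ => by simp) ?_
  rintro v ⟨x, rfl⟩
  exact ⟨fun _ => 0, funext fun i => i.elim0⟩

/-- **`Level 3` fails.**  `⌊log₂ 3⌋² = 1`, `M = 8² = 64`, `E(j) = 1 + 64 j`; the curve
`(x^65 + x^129, x^193 + x^257, x^321 + x^385) = x^65 (1 + x^64) · (1, x^128, x^256)` lies in the cone
`w₀ w₂ = w₁²`, the image of `(t, u) ↦ (t², t u, u²)`: take `t = √(x^65 + x^129)`,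
`u = (x^193 + x^257) / t` (and `u = 0` when `t = 0`, where the whole point is `0`). -/
theorem level_three_false : ¬ (∀ Γ : Fin 3 → MvPolynomial (Fin (3 - 1)) ℂ, (∀ i, (Γ i).totalDegree ≤ 2) →
      ¬ (Set.range (fun x : ℂ => fun i : Fin 3 => x ^ (∑ k ∈ Finset.range (Nat.log 2 3 ^ 2 + 1), ((2 * (i : ℕ) + 1) * (2 * 3 + 2) ^ (Nat.log 2 3 ^ 2 + 1)) ^ k) + x ^ (∑ k ∈ Finset.range (Nat.log 2 3 ^ 2 + 1), ((2 * (i : ℕ) + 2) * (2 * 3 + 2) ^ (Nat.log 2 3 ^ 2 + 1)) ^ k))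
        ⊆ Set.range (fun y : Fin (3 - 1) → ℂ => fun i : Fin 3 => MvPolynomial.eval y (Γ i)))) := by
  intro h
  have hlog : Nat.log 2 3 = 1 :=
    (Nat.log_eq_iff (b := 2) (m := 1) (n := 3) (Or.inl one_ne_zero)).mpr ⟨by norm_num, by norm_num⟩
  have hdeg : ∀ i : Fin 3, ((![MvPolynomial.X 0 ^ 2, MvPolynomial.X 0 * MvPolynomial.X 1,
      MvPolynomial.X 1 ^ 2] : Fin 3 → MvPolynomial (Fin (3 - 1)) ℂ) i).totalDegree ≤ 2 := by
    intro i
    fin_cases i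
    · simp [MvPolynomial.totalDegree_X_pow]
    · exact le_trans (MvPolynomial.totalDegree_mul _ _) (by simp [MvPolynomial.totalDegree_X])
    · simp [MvPolynomial.totalDegree_X_pow]
  refine h _ hdeg ?_
  rintro v ⟨x, rfl⟩
  obtain ⟨r, hr⟩ := IsAlgClosed.exists_pow_nat_eq (x ^ 65 + x ^ 129) (by norm_num : 0 < 2)
  refine ⟨![r, (x ^ 193 + x ^ 257) / r], ?_⟩
  have e2 : (x ^ 193 + x ^ 257 : ℂ) = x ^ 128 * (x ^ 65 + x ^ 129) := by ring
  have e3 : (x ^ 321 + x ^ 385 : ℂ) = x ^ 256 * (x ^ 65 + x ^ 129) := by ring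
  funext i
  fin_cases i
  · simp [hlog, Finset.sum_range_succ]
    rw [← hr]
  · simp [hlog, Finset.sum_range_succ]
    by_cases hr0 : r = 0
    · subst hr0
      have h1 : (x ^ 65 + x ^ 129 : ℂ) = 0 := by rw [← hr]; norm_num
      rw [e2, h1]; simp
    · field_simp
  · simp [hlog, Finset.sum_range_succ]
    by_cases hr0 : r = 0
    · subst hr0
      have h1 : (x ^ 65 + x ^ 129 : ℂ) = 0 := by rw [← hr]; norm_num
      rw [e3, h1]; simp
    · have h1 : (x ^ 65 + x ^ 129 : ℂ) ≠ 0 := by rw [← hr]; exact pow_ne_zero _ hr0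
      rw [div_pow, hr, div_eq_iff h1]; ring

/-- Every witness `m₀` of `BinomialCandidate` satisfies `4 ≤ m₀` (tightness of the guard `∃ m₀`;
the hypothesis is `∀ m ≥ m₀, Level m` verbatim). -/
theorem four_le_of_binomialCandidate_witness (m₀ : ℕ)
    (hm : ∀ m ≥ m₀, (∀ Γ : Fin m → MvPolynomial (Fin (m - 1)) ℂ, (∀ i, (Γ i).totalDegree ≤ 2) →
      ¬ (Set.range (fun x : ℂ => fun i : Fin m => x ^ (∑ k ∈ Finset.range (Nat.log 2 m ^ 2 + 1), ((2 * (i : ℕ) + 1) * (2 * m + 2) ^ (Nat.log 2 m ^ 2 + 1)) ^ k) + x ^ (∑ k ∈ Finset.range (Nat.log 2 m ^ 2 + 1), ((2 * (i : ℕ) + 2) * (2 * m + 2) ^ (Nat.log 2 m ^ 2 + 1)) ^ k))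
        ⊆ Set.range (fun y : Fin (m - 1) → ℂ => fun i : Fin m => MvPolynomial.eval y (Γ i))))) :
    4 ≤ m₀ := by
  by_contra hlt
  exact level_three_false (hm 3 (by omega))

/-- Sanity link: `BinomialCandidate` is literally `∃ m₀, ∀ m ≥ m₀, Level m`. -/
theorem binomialCandidate_iff_levels : BinomialCandidate ↔ ∃ m₀ : ℕ, ∀ m ≥ m₀, (∀ Γ : Fin m → MvPolynomial (Fin (m - 1)) ℂ, (∀ i, (Γ i).totalDegree ≤ 2) →
      ¬ (Set.range (fun x : ℂ => fun i : Fin m => x ^ (∑ k ∈ Finset.range (Nat.log 2 m ^ 2 + 1), ((2 * (i : ℕ) + 1) * (2 * m + 2) ^ (Nat.log 2 m ^ 2 + 1)) ^ k) + x ^ (∑ k ∈ Finset.range (Nat.log 2 m ^ 2 + 1), ((2 * (i : ℕ) + 2) * (2 * m + 2) ^ (Nat.log 2 m ^ 2 + 1)) ^ k))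
        ⊆ Set.range (fun y : Fin (m - 1) → ℂ => fun i : Fin m => MvPolynomial.eval y (Γ i)))) :=
  Iff.rfl

/-- Mutation: WITHOUT the degree bound the eventual statement is false (witness level `m₀ + 2`,
`Γ_i = X₀^{E(2i+1)} + X₀^{E(2i+2)}`).  Any proof of `BinomialCandidate` uses `totalDegree ≤ 2`. -/
theorem false_withoutDegree : ¬ (∃ m₀ : ℕ, ∀ m ≥ m₀, ∀ Γ : Fin m → MvPolynomial (Fin (m - 1)) ℂ,
    ¬ (Set.range (fun x : ℂ => fun i : Fin m => x ^ (∑ k ∈ Finset.range (Nat.log 2 m ^ 2 + 1), ((2 * (i : ℕ) + 1) * (2 * m + 2) ^ (Nat.log 2 m ^ 2 + 1)) ^ k) + x ^ (∑ k ∈ Finset.range (Nat.log 2 m ^ 2 + 1), ((2 * (i : ℕ) + 2) * (2 * m + 2) ^ (Nat.log 2 m ^ 2 + 1)) ^ k))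
      ⊆ Set.range (fun y : Fin (m - 1) → ℂ => fun i : Fin m => MvPolynomial.eval y (Γ i)))) := by
  rintro ⟨m₀, h⟩
  have hlt : 0 < m₀ + 2 - 1 := by omega
  refine h (m₀ + 2) (by omega) (fun i =>
      MvPolynomial.X (⟨0, hlt⟩ : Fin (m₀ + 2 - 1)) ^
          (∑ k ∈ Finset.range (Nat.log 2 (m₀ + 2) ^ 2 + 1), ((2 * (i : ℕ) + 1) * (2 * (m₀ + 2) + 2) ^ (Nat.log 2 (m₀ + 2) ^ 2 + 1)) ^ k)
        + MvPolynomial.X (⟨0, hlt⟩ : Fin (m₀ + 2 - 1)) ^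
          (∑ k ∈ Finset.range (Nat.log 2 (m₀ + 2) ^ 2 + 1), ((2 * (i : ℕ) + 2) * (2 * (m₀ + 2) + 2) ^ (Nat.log 2 (m₀ + 2) ^ 2 + 1)) ^ k)) ?_
  rintro v ⟨x, rfl⟩
  refine ⟨fun _ => x, funext fun i => ?_⟩
  simp only [map_add, map_pow, MvPolynomial.eval_X]

/-- Mutation: with `m` variables instead of `m - 1` the eventual statement is false at every level
(`Γ_i = X_i`, degree `1`).  Any proof of `BinomialCandidate` uses the variable deficit. -/
theorem false_withoutDeficit : ¬ (∃ m₀ : ℕ, ∀ m ≥ m₀, ∀ Γ : Fin m → MvPolynomial (Fin m) ℂ,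
    (∀ i, (Γ i).totalDegree ≤ 2) →
    ¬ (Set.range (fun x : ℂ => fun i : Fin m => x ^ (∑ k ∈ Finset.range (Nat.log 2 m ^ 2 + 1), ((2 * (i : ℕ) + 1) * (2 * m + 2) ^ (Nat.log 2 m ^ 2 + 1)) ^ k) + x ^ (∑ k ∈ Finset.range (Nat.log 2 m ^ 2 + 1), ((2 * (i : ℕ) + 2) * (2 * m + 2) ^ (Nat.log 2 m ^ 2 + 1)) ^ k))
      ⊆ Set.range (fun y : Fin m → ℂ => fun i : Fin m => MvPolynomial.eval y (Γ i)))) := by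
  rintro ⟨m₀, h⟩
  refine h m₀ le_rfl (fun i => MvPolynomial.X i) (fun i => ?_) ?_
  · simp [MvPolynomial.totalDegree_X]
  · rintro v ⟨x, rfl⟩
    exact ⟨(fun x : ℂ => fun i : Fin m₀ => x ^ (∑ k ∈ Finset.range (Nat.log 2 m₀ ^ 2 + 1), ((2 * (i : ℕ) + 1) * (2 * m₀ + 2) ^ (Nat.log 2 m₀ ^ 2 + 1)) ^ k) + x ^ (∑ k ∈ Finset.range (Nat.log 2 m₀ ^ 2 + 1), ((2 * (i : ℕ) + 2) * (2 * m₀ + 2) ^ (Nat.log 2 m₀ ^ 2 + 1)) ^ k)) x, funext fun i => by simp⟩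

/-- Junk instance excluded for the right reason: a constant map never swallows the curve
(`f(0) = 0`, `f(1) = (2, …, 2)`), at every level `m ≥ 1`. -/
theorem level_const (m : ℕ) (hm : 1 ≤ m) (c : Fin m → ℂ) :
    ¬ (Set.range (fun x : ℂ => fun i : Fin m => x ^ (∑ k ∈ Finset.range (Nat.log 2 m ^ 2 + 1), ((2 * (i : ℕ) + 1) * (2 * m + 2) ^ (Nat.log 2 m ^ 2 + 1)) ^ k) + x ^ (∑ k ∈ Finset.range (Nat.log 2 m ^ 2 + 1), ((2 * (i : ℕ) + 2) * (2 * m + 2) ^ (Nat.log 2 m ^ 2 + 1)) ^ k)) ⊆ Set.range (fun _ : Fin (m - 1) → ℂ => c)) := by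
  intro h
  obtain ⟨_, h0⟩ := h ⟨0, rfl⟩
  obtain ⟨_, h1⟩ := h ⟨1, rfl⟩
  have e0 := congrFun h0 ⟨0, hm⟩
  have e1 := congrFun h1 ⟨0, hm⟩
  have hpos : ∀ j : ℕ, 0 < ∑ k ∈ Finset.range (Nat.log 2 m ^ 2 + 1),
      (j * (2 * m + 2) ^ (Nat.log 2 m ^ 2 + 1)) ^ k :=
    fun j => Finset.sum_pos' (fun _ _ => Nat.zero_le _) ⟨0, by simp, by simp⟩
  simp only [one_pow] at e0 e1
  rw [zero_pow (hpos _).ne', zero_pow (hpos _).ne', add_zero] at e0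
  rw [e0] at e1
  norm_num at e1

end Summit.ValiantsHypothesis.ValiantsHypothesis.Theorems.BinomialCandidate.Negative
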